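import Mathlib.Combinatorics.SimpleGraph.Finite
import Literature.InformationTheory.QuantumCodes.CSS
import HarnessLib

/-!
# The Tanner graph of a check matrix and of a CSS code

Bravyi–Cross–Gambetta–Maslov–Rall–Yoder [BravyiEtAl2024, §2]: "Each quantum code can be described by a
Tanner graph `G` such that each vertex of `G` represents either a data qubit or a check operator. A
check vertex `i` and a data vertex `j` are connected by an edge if the `i`-th check operator acts
non-trivially on the `j`-th data qubit (by applying Pauli `X` or `Z`)."  For a classical parity-check
matrix `H` this is the usual bipartite Tanner graph (checks ⊔ bits, `i — q` iff `H i q ≠ 0`); for a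
CSS code presented by `(H^X, H^Z)` (the tree's `CSSCode`, `QuantumCodes/CSS.lean`) the check vertices
are the `X`-checks ⊔ the `Z`-checks, i.e. the Tanner graph of the stacked matrix `[H^X ; H^Z]`.

This file gives the DEFINITIONS as Mathlib `SimpleGraph`s and the bookkeeping lemmas every later
statement about connectivity / layout / degree uses:

* `tannerGraph (H : Matrix ι Q R) : SimpleGraph (ι ⊕ Q)` and its adjacency lemmas (`tannerGraph_adj_inl_inr`
  etc.; there are no check–check and no bit–bit edges: the graph is bipartite by construction);
* `CSSCode.tannerGraph (C : CSSCode RX RZ Q) : SimpleGraph ((RX ⊕ RZ) ⊕ Q) := tannerGraph [H^X ; H^Z]`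
  with `adj_xCheck_qubit : X-check i — qubit q ↔ H^X i q ≠ 0`, `adj_zCheck_qubit : Z-check j — q ↔ H^Z j q ≠ 0`;
* DEGREES = WEIGHTS: the degree of a check vertex is the Hamming weight of its row, the degree of a
  bit vertex is the weight of its column (`tannerGraph_degree_inl/inr`); for a CSS code the degree of
  qubit `q` is (column weight of `H^X` at `q`) + (column weight of `H^Z` at `q`) — "each qubit
  participates in six checks (three `X`-type plus three `Z`-type checks)" [BravyiEtAl2024, §4] is the
  instance `3 + 3` (`CSSCode.tannerGraph_degree_qubit`).

The two-block / bivariate-bicycle specifics (translation automorphisms, BCGMRY24 Lemma 3 on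
connectivity, Lemma 4 on the toric layout) are in `TwoBlockTannerGraph.lean` / `TwoBlockToricLayout.lean`.

## What is NOT here
* Thickness / planarity ([BravyiEtAl2024, Lemma 2]: "the Tanner graph has thickness `θ ≤ 2`"): Mathlib
  has no notion of planar graph (2026-08), so the statement is not typed.
* No `instance` is declared (typer lint): decidability of `Adj` is the explicit `def tannerGraph.decAdj`,
  and degree lemmas take `[Fintype (neighborSet v)]` as Mathlib's `SimpleGraph.degree` does.
* `checkGraph H` of `MinWeightDecodingClusters.lean` is a DIFFERENT graph (qubit–qubit adjacency "share
  a check", the square of the Tanner graph restricted to bits); nothing here restates it.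

## References (locators read on the page)
* [BravyiEtAl2024] S. Bravyi, A. W. Cross, J. M. Gambetta, D. Maslov, P. Rall, T. J. Yoder,
  *High-threshold and low-overhead fault-tolerant quantum memory*, Nature 627 (2024) 778–782 =
  arXiv:2308.07915: §2 (held text paper:arxiv-2308.07915 chunk p0005 L59–63, Tanner graph); §3
  (p0007 L18 "The Tanner graph of any BB code has vertex degree six"); §4 (p0009 L53–56 "weight-6
  check operators and each qubit participates in six checks (three X-type plus three Z-type checks).
  Accordingly, the code QC(A,B) has a degree-6 Tanner graph").
* R. M. Tanner, *A recursive approach to low complexity codes*, IEEE Trans. IT 27 (1981) 533 — the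
  bipartite graph of a parity-check matrix (folklore since; not cited per decl).

`lean search` (2026-08-27): no `tannerGraph` / bipartite check–bit graph in Mathlib or the tree
(`checkGraph` only, see above); Mathlib supplies `SimpleGraph`, `neighborFinset`, `degree`, `hammingNorm`.
-/

namespace Literature.InformationTheory.QuantumCodes

open Matrix

/-! ### The Tanner graph of one check matrix -/

section OneMatrix

variable {ι Q R : Type*} [Zero R]

/-- The adjacency relation of the Tanner graph of a check matrix `H`: check `i` and bit `q` are adjacent
iff `H i q ≠ 0`; two checks, or two bits, are never adjacent.
[cite: BravyiEtAl2024, §2 "A check vertex i and a data vertex j are connected by an edge if the i-th check operator acts non-trivially on the j-th data qubit" (arXiv:2308.07915 chunk p0005 L61–63)] -/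
def TannerAdj (H : Matrix ι Q R) : ι ⊕ Q → ι ⊕ Q → Prop
  | Sum.inl i, Sum.inr q => H i q ≠ 0
  | Sum.inr q, Sum.inl i => H i q ≠ 0
  | Sum.inl _, Sum.inl _ => False
  | Sum.inr _, Sum.inr _ => False

/-- **The Tanner graph** of a check matrix `H : Matrix ι Q R`: the bipartite simple graph on
`ι ⊕ Q` (check vertices `inl i`, bit / data-qubit vertices `inr q`) with `inl i — inr q` iff `H i q ≠ 0`.
[cite: BravyiEtAl2024, §2 "each vertex of G represents either a data qubit or a check operator. A check vertex i and a data vertex j are connected by an edge if the i-th check operator acts non-trivially on the j-th data qubit" (arXiv:2308.07915 chunk p0005 L59–63)] -/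
def tannerGraph (H : Matrix ι Q R) : SimpleGraph (ι ⊕ Q) where
  Adj := TannerAdj H
  symm := ⟨by
    rintro (i | q) (i' | q') h
    · exact h.elim
    · exact h
    · exact h
    · exact h.elim⟩
  loopless := ⟨by
    rintro (i | q) h
    · exact h
    · exact h⟩

/-- Check `i` — bit `q` in the Tanner graph iff `H i q ≠ 0`. [cite: BravyiEtAl2024, §2 (arXiv:2308.07915 chunk p0005 L61–63)] -/
@[simp] theorem tannerGraph_adj_inl_inr (H : Matrix ι Q R) (i : ι) (q : Q) :
    (tannerGraph H).Adj (Sum.inl i) (Sum.inr q) ↔ H i q ≠ 0 := Iff.rfl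

/-- Bit `q` — check `i` in the Tanner graph iff `H i q ≠ 0`. [cite: BravyiEtAl2024, §2 (arXiv:2308.07915 chunk p0005 L61–63)] -/
@[simp] theorem tannerGraph_adj_inr_inl (H : Matrix ι Q R) (q : Q) (i : ι) :
    (tannerGraph H).Adj (Sum.inr q) (Sum.inl i) ↔ H i q ≠ 0 := Iff.rfl

/-- Two check vertices are never adjacent (the Tanner graph is bipartite).
[cite: BravyiEtAl2024, §2 (arXiv:2308.07915 chunk p0005 L59–63)] -/
@[simp] theorem tannerGraph_not_adj_inl_inl (H : Matrix ι Q R) (i i' : ι) :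
    ¬ (tannerGraph H).Adj (Sum.inl i) (Sum.inl i') := fun h => h

/-- Two bit vertices are never adjacent (the Tanner graph is bipartite).
[cite: BravyiEtAl2024, §2 (arXiv:2308.07915 chunk p0005 L59–63)] -/
@[simp] theorem tannerGraph_not_adj_inr_inr (H : Matrix ι Q R) (q q' : Q) :
    ¬ (tannerGraph H).Adj (Sum.inr q) (Sum.inr q') := fun h => h

/-- A neighbour of a check vertex is a bit vertex. [cite: BravyiEtAl2024, §2 (arXiv:2308.07915 chunk p0005 L59–63)] -/
theorem tannerGraph_adj_inl_iff (H : Matrix ι Q R) (i : ι) (y : ι ⊕ Q) :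
    (tannerGraph H).Adj (Sum.inl i) y ↔ ∃ q, y = Sum.inr q ∧ H i q ≠ 0 := by
  rcases y with i' | q
  · exact ⟨fun h => h.elim, fun ⟨q, hq, _⟩ => absurd hq Sum.inl_ne_inr⟩
  · exact ⟨fun h => ⟨q, rfl, h⟩, fun ⟨q', hq', h⟩ => by cases Sum.inr_injective hq'; exact h⟩

/-- A neighbour of a bit vertex is a check vertex. [cite: BravyiEtAl2024, §2 (arXiv:2308.07915 chunk p0005 L59–63)] -/
theorem tannerGraph_adj_inr_iff (H : Matrix ι Q R) (q : Q) (y : ι ⊕ Q) :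
    (tannerGraph H).Adj (Sum.inr q) y ↔ ∃ i, y = Sum.inl i ∧ H i q ≠ 0 := by
  rcases y with i | q'
  · exact ⟨fun h => ⟨i, rfl, h⟩, fun ⟨i', hi', h⟩ => by cases Sum.inl_injective hi'; exact h⟩
  · exact ⟨fun h => h.elim, fun ⟨i, hi, _⟩ => absurd hi Sum.inr_ne_inl⟩

/-- Decidability of adjacency in the Tanner graph (an explicit `def`, not an instance: supply it with
`haveI` / `@` where a `decide` is wanted). [cite: BravyiEtAl2024, §2 (arXiv:2308.07915 chunk p0005 L59–63)] -/
@[reducible] def tannerGraph.decAdj (H : Matrix ι Q R) [DecidableEq R] : DecidableRel (tannerGraph H).Adj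
  | Sum.inl i, Sum.inr q => inferInstanceAs (Decidable (H i q ≠ 0))
  | Sum.inr q, Sum.inl i => inferInstanceAs (Decidable (H i q ≠ 0))
  | Sum.inl _, Sum.inl _ => inferInstanceAs (Decidable False)
  | Sum.inr _, Sum.inr _ => inferInstanceAs (Decidable False)

/-- Re-indexing checks and bits by bijections is a graph isomorphism of Tanner graphs:
`tannerGraph (H.submatrix eι eQ) ≃g tannerGraph H` along `Sum.map eι eQ`. [folklore] -/
def tannerGraphSubmatrixIso {ι' Q' : Type*} (H : Matrix ι Q R) (eι : ι' ≃ ι) (eQ : Q' ≃ Q) :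
    tannerGraph (H.submatrix eι eQ) ≃g tannerGraph H where
  toEquiv := Equiv.sumCongr eι eQ
  map_rel_iff' := by
    rintro (i | q) (i' | q') <;> rfl

variable [DecidableEq R]

/-- The neighbours of check vertex `i` are the bits `q` with `H i q ≠ 0`.
[cite: BravyiEtAl2024, §2 (arXiv:2308.07915 chunk p0005 L61–63)] -/
theorem tannerGraph_neighborFinset_inl [Fintype Q] (H : Matrix ι Q R) (i : ι)
    [Fintype ((tannerGraph H).neighborSet (Sum.inl i))] :
    (tannerGraph H).neighborFinset (Sum.inl i) =
      (Finset.univ.filter fun q => H i q ≠ 0).map Function.Embedding.inr := by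
  ext y
  rw [SimpleGraph.mem_neighborFinset, tannerGraph_adj_inl_iff]
  simp only [Finset.mem_map, Finset.mem_filter, Finset.mem_univ, true_and,
    Function.Embedding.inr_apply]
  exact ⟨fun ⟨q, hy, h⟩ => ⟨q, h, hy.symm⟩, fun ⟨q, h, hy⟩ => ⟨q, hy.symm, h⟩⟩

/-- The neighbours of bit vertex `q` are the checks `i` with `H i q ≠ 0`.
[cite: BravyiEtAl2024, §2 (arXiv:2308.07915 chunk p0005 L61–63)] -/
theorem tannerGraph_neighborFinset_inr [Fintype ι] (H : Matrix ι Q R) (q : Q)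
    [Fintype ((tannerGraph H).neighborSet (Sum.inr q))] :
    (tannerGraph H).neighborFinset (Sum.inr q) =
      (Finset.univ.filter fun i => H i q ≠ 0).map Function.Embedding.inl := by
  ext y
  rw [SimpleGraph.mem_neighborFinset, tannerGraph_adj_inr_iff]
  simp only [Finset.mem_map, Finset.mem_filter, Finset.mem_univ, true_and,
    Function.Embedding.inl_apply]
  exact ⟨fun ⟨i, hy, h⟩ => ⟨i, h, hy.symm⟩, fun ⟨i, h, hy⟩ => ⟨i, hy.symm, h⟩⟩

/-- **Check degree = row weight**: the degree of check vertex `i` in the Tanner graph is the Hamming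
weight of row `i` of `H` (the weight of the `i`-th check operator).
[cite: BravyiEtAl2024, §4 "the code QC(A,B) has weight-6 check operators … Accordingly, the code has a degree-6 Tanner graph" (arXiv:2308.07915 chunk p0009 L53–56)] -/
theorem tannerGraph_degree_inl [Fintype Q] (H : Matrix ι Q R) (i : ι)
    [Fintype ((tannerGraph H).neighborSet (Sum.inl i))] :
    (tannerGraph H).degree (Sum.inl i) = hammingNorm (H i) := by
  rw [← SimpleGraph.card_neighborFinset_eq_degree, tannerGraph_neighborFinset_inl, Finset.card_map,
    hammingNorm]

/-- **Bit degree = column weight**: the degree of bit vertex `q` is the Hamming weight of column `q`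
of `H` (the number of checks acting on bit `q`).
[cite: BravyiEtAl2024, §4 "each qubit participates in six checks" (arXiv:2308.07915 chunk p0009 L53–56)] -/
theorem tannerGraph_degree_inr [Fintype ι] (H : Matrix ι Q R) (q : Q)
    [Fintype ((tannerGraph H).neighborSet (Sum.inr q))] :
    (tannerGraph H).degree (Sum.inr q) = hammingNorm (fun i => H i q) := by
  rw [← SimpleGraph.card_neighborFinset_eq_degree, tannerGraph_neighborFinset_inr, Finset.card_map,
    hammingNorm]

end OneMatrix

/-! ### The Tanner graph of a CSS code `(H^X, H^Z)` -/

namespace CSSCode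

variable {RX RZ Q : Type*} [Fintype Q]

/-- **The Tanner graph of a CSS code** presented by `(H^X, H^Z)`: vertices = `X`-checks ⊔ `Z`-checks ⊔
qubits, i.e. `(RX ⊕ RZ) ⊕ Q`; `X`-check `i` — qubit `q` iff `H^X i q ≠ 0` (the check applies Pauli `X`
there), `Z`-check `j` — qubit `q` iff `H^Z j q ≠ 0`. It is the Tanner graph of the stacked check matrix
`[H^X ; H^Z]`. [cite: BravyiEtAl2024, §2 "each vertex of G represents either a data qubit or a check operator … connected by an edge if the i-th check operator acts non-trivially on the j-th data qubit (by applying Pauli X or Z)" (arXiv:2308.07915 chunk p0005 L59–63)] -/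
def tannerGraph (C : CSSCode RX RZ Q) : SimpleGraph ((RX ⊕ RZ) ⊕ Q) :=
  QuantumCodes.tannerGraph (Matrix.fromRows C.HX C.HZ)

/-- Unfolding: the CSS Tanner graph is the Tanner graph of `[H^X ; H^Z]`.
[cite: BravyiEtAl2024, §2 (arXiv:2308.07915 chunk p0005 L59–63)] -/
theorem tannerGraph_def (C : CSSCode RX RZ Q) :
    C.tannerGraph = QuantumCodes.tannerGraph (Matrix.fromRows C.HX C.HZ) := rfl

/-- `X`-check `i` — qubit `q` iff `H^X i q ≠ 0`. [cite: BravyiEtAl2024, §2 (arXiv:2308.07915 chunk p0005 L61–63)] -/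
@[simp] theorem adj_xCheck_qubit (C : CSSCode RX RZ Q) (i : RX) (q : Q) :
    C.tannerGraph.Adj (Sum.inl (Sum.inl i)) (Sum.inr q) ↔ C.HX i q ≠ 0 := Iff.rfl

/-- `Z`-check `j` — qubit `q` iff `H^Z j q ≠ 0`. [cite: BravyiEtAl2024, §2 (arXiv:2308.07915 chunk p0005 L61–63)] -/
@[simp] theorem adj_zCheck_qubit (C : CSSCode RX RZ Q) (j : RZ) (q : Q) :
    C.tannerGraph.Adj (Sum.inl (Sum.inr j)) (Sum.inr q) ↔ C.HZ j q ≠ 0 := Iff.rfl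

/-- Qubit `q` — `X`-check `i` iff `H^X i q ≠ 0`. [cite: BravyiEtAl2024, §2 (arXiv:2308.07915 chunk p0005 L61–63)] -/
@[simp] theorem adj_qubit_xCheck (C : CSSCode RX RZ Q) (q : Q) (i : RX) :
    C.tannerGraph.Adj (Sum.inr q) (Sum.inl (Sum.inl i)) ↔ C.HX i q ≠ 0 := Iff.rfl

/-- Qubit `q` — `Z`-check `j` iff `H^Z j q ≠ 0`. [cite: BravyiEtAl2024, §2 (arXiv:2308.07915 chunk p0005 L61–63)] -/
@[simp] theorem adj_qubit_zCheck (C : CSSCode RX RZ Q) (q : Q) (j : RZ) :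
    C.tannerGraph.Adj (Sum.inr q) (Sum.inl (Sum.inr j)) ↔ C.HZ j q ≠ 0 := Iff.rfl

/-- No check–check edges. [cite: BravyiEtAl2024, §2 (arXiv:2308.07915 chunk p0005 L59–63)] -/
@[simp] theorem not_adj_check_check (C : CSSCode RX RZ Q) (c c' : RX ⊕ RZ) :
    ¬ C.tannerGraph.Adj (Sum.inl c) (Sum.inl c') := fun h => h

/-- No qubit–qubit edges. [cite: BravyiEtAl2024, §2 (arXiv:2308.07915 chunk p0005 L59–63)] -/
@[simp] theorem not_adj_qubit_qubit (C : CSSCode RX RZ Q) (q q' : Q) :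
    ¬ C.tannerGraph.Adj (Sum.inr q) (Sum.inr q') := fun h => h

/-- The `X ↔ Z` exchange `CSSCode.swap` only relabels the check vertices (`inl ↔ inr` on `RX ⊕ RZ`):
an isomorphism of Tanner graphs. [folklore] -/
def tannerGraphSwapIso (C : CSSCode RX RZ Q) : C.swap.tannerGraph ≃g C.tannerGraph where
  toEquiv := Equiv.sumCongr (Equiv.sumComm RZ RX) (Equiv.refl Q)
  map_rel_iff' := by
    rintro ((j | i) | q) ((j' | i') | q') <;> rfl

/-- **Degree of an `X`-check** = weight of its row of `H^X` (the weight of the check operator).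
[cite: BravyiEtAl2024, §4 "weight-6 check operators" (arXiv:2308.07915 chunk p0009 L53–56)] -/
theorem tannerGraph_degree_xCheck (C : CSSCode RX RZ Q) (i : RX)
    [Fintype (C.tannerGraph.neighborSet (Sum.inl (Sum.inl i)))] :
    C.tannerGraph.degree (Sum.inl (Sum.inl i)) = hammingNorm (C.HX i) := by
  have h := @tannerGraph_degree_inl _ _ _ _ _ _ (Matrix.fromRows C.HX C.HZ) (Sum.inl i) ‹_›
  exact h.trans (congrArg hammingNorm (funext fun q => Matrix.fromRows_apply_inl C.HX C.HZ i q))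

/-- **Degree of a `Z`-check** = weight of its row of `H^Z`.
[cite: BravyiEtAl2024, §4 "weight-6 check operators" (arXiv:2308.07915 chunk p0009 L53–56)] -/
theorem tannerGraph_degree_zCheck (C : CSSCode RX RZ Q) (j : RZ)
    [Fintype (C.tannerGraph.neighborSet (Sum.inl (Sum.inr j)))] :
    C.tannerGraph.degree (Sum.inl (Sum.inr j)) = hammingNorm (C.HZ j) := by
  have h := @tannerGraph_degree_inl _ _ _ _ _ _ (Matrix.fromRows C.HX C.HZ) (Sum.inr j) ‹_›
  exact h.trans (congrArg hammingNorm (funext fun q => Matrix.fromRows_apply_inr C.HX C.HZ j q))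

/-- **Degree of a qubit** = (number of `X`-checks on it) + (number of `Z`-checks on it), i.e. column
weight of `H^X` plus column weight of `H^Z` ("each qubit participates in six checks (three `X`-type
plus three `Z`-type checks)").
[cite: BravyiEtAl2024, §4 (arXiv:2308.07915 chunk p0009 L53–56)] -/
theorem tannerGraph_degree_qubit [Fintype RX] [Fintype RZ] (C : CSSCode RX RZ Q) (q : Q)
    [Fintype (C.tannerGraph.neighborSet (Sum.inr q))] :
    C.tannerGraph.degree (Sum.inr q) =
      hammingNorm (fun i => C.HX i q) + hammingNorm (fun j => C.HZ j q) := by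
  refine (@tannerGraph_degree_inr _ _ _ _ _ _ (Matrix.fromRows C.HX C.HZ) q ‹_›).trans ?_
  simp only [hammingNorm, Finset.card_filter, Fintype.sum_sum_type, Matrix.fromRows_apply_inl,
    Matrix.fromRows_apply_inr]
  congr 1

end CSSCode

end Literature.InformationTheory.QuantumCodes
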